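import Summits.QuantumFields.GaugeBoot.PlanarRelaxationBlock
import Summits.QuantumFields.GaugeBoot.ClassBWords
import Mathlib.Probability.Moments.Variance
import HarnessLib

/-!
# The planar data of a state on `ℤ^d` read at finite `N`: `W(C) = Re E t_C`, `Q(A,B) = Re E[t_A t_B]`, and the imaginary-part covariances (gauge-boot, large-`N` supplement 2)

HONEST FRAMING (cell `pub-gaugeboot`, page 1 of every file): the venture produces certified bounds
on lattice expectations at stated coupling, gauge group, dimension and torus size; NOT a mass gap,
NOT a continuum limit, NOT a string tension; NOT large `N` unless marked CONDITIONAL; NOT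
Yang–Mills-summit-bearing (barriers `FixedCouplingUltralocality`, `PerturbativeInvisibility`).
Bookkeeping for ANY finite measure on `ℤ^d` configurations; this file certifies no number.

## Content

For a compact `G` with a continuous `N`-dimensional representation `ρ`, a measure `μ` on
`LGConfig d G` and a base point `x ∈ ℤ^d` (all words based at `x`, `ClassBWords` vocabulary):

* `loopTrZd ρ x C U = tr ρ(hol_x C)/N` — the normalised complex loop variable `t_C`
  (`‖t_C‖ ≤ 1`, measurable, `Re t_C = wordLoopZd`, `t_{C⁻¹} = conj t_C` for closed `C`);
* the PLANAR DATA OF THE STATE: `loopW ρ μ x C = Re E t_C` (Kazakov–Zheng's `W[C]` read at finite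
  `N`; `= ∫ wordLoopZd`), `loopQ ρ μ x A B = Re E[t_A t_B]` (their product `W[A] W[B]` read as the
  PAIR EXPECTATION — the tree's `d(A, B)` of `LoopEquationPairForm` / `ZdLoopEquationStates`), and the
  IMAGINARY-PART COVARIANCE `loopImCov ρ μ x A B = E[Im t_A · Im t_B]`;
* the dictionary: `loopQ_nil_left/right` (`Q([], C) = W(C)`: a trivial split is a linear term),
  `loopQ_comm`, ★ `loopQ_sub_loopQ_reverse` — **`Q(A, B) − Q(A, B⁻¹) = −2 E[Im t_A Im t_B]`** (the
  `SU(N)` pair plaquette terms of the finite-`N` loop equation are imaginary-part covariances),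
  `sq_loopImCov_le` (`E[Im t_A Im t_B]² ≤ E[(Im t_A)²]`, Jensen), `abs_loopImCov_le_one`;
* ★★ `shorPairing_loopData_ge` — M1 applied: for loops `ℓ_A` and a rank-one relaxation multiplier,
  `⟨m mᵀ, [[1, Wᵀ], [W, Q]]⟩ ≥ −E(Σ_A m_A Im t_{ℓ_A})² ≥ −#ι Σ_A m_A² E(Im t_{ℓ_A})²`.

[folklore] bookkeeping (Kazakov–Zheng arXiv:2203.11360 §3.2; Anderson–Kruczenski 2017 §2).
-/

noncomputable section

open MeasureTheory ProbabilityTheory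
open scoped BigOperators
open Literature.Probability.LatticeModels (Site)
open Literature.MathematicalPhysics.QuantumLattice
open Literature.RepresentationTheory.CompactGroups

namespace Summit.QuantumFields.GaugeBoot

/-! ## Two probability lemmas: Jensen for the square, and `E[ab]² ≤ E[a²]` for `|b| ≤ 1` -/

section Abstract

variable {Ω : Type*} [MeasurableSpace Ω] {μ : Measure Ω} [IsProbabilityMeasure μ]

/-- Jensen for the square on a probability space: `(E Y)² ≤ E Y²` for bounded measurable `Y`
(`= Var Y ≥ 0`). [folklore] -/
theorem sq_integral_le_integral_sq {Y : Ω → ℝ} (hY : AEStronglyMeasurable Y μ) {C : ℝ} (hb : ∀ ω, |Y ω| ≤ C) :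
    (∫ ω, Y ω ∂μ) ^ 2 ≤ ∫ ω, Y ω ^ 2 ∂μ := by
  have hY2 : MemLp Y 2 μ := MemLp.of_bound hY C (Filter.Eventually.of_forall fun ω => by
    rw [Real.norm_eq_abs]; exact hb ω)
  have hv := variance_nonneg Y μ
  rw [variance_eq_sub hY2] at hv
  have : μ[Y ^ 2] = ∫ ω, Y ω ^ 2 ∂μ := rfl
  linarith

/-- `E[a b]² ≤ E[a²]` for real observables with `|a|, |b| ≤ 1` on a probability space
(`|E[ab]| ≤ E|a| ≤ (E a²)^{1/2}`). [folklore] -/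
theorem sq_integral_mul_le_integral_sq {a b : Ω → ℝ} (ha : AEStronglyMeasurable a μ)
    (ha1 : ∀ ω, |a ω| ≤ 1) (hb1 : ∀ ω, |b ω| ≤ 1) :
    (∫ ω, a ω * b ω ∂μ) ^ 2 ≤ ∫ ω, a ω ^ 2 ∂μ := by
  have hai : Integrable (fun ω => |a ω|) μ :=
    (Integrable.of_bound ha 1 (Filter.Eventually.of_forall fun ω => by rw [Real.norm_eq_abs]; exact ha1 ω)).abs
  have h1 : |∫ ω, a ω * b ω ∂μ| ≤ ∫ ω, |a ω| ∂μ := by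
    refine (abs_integral_le_integral_abs).trans (integral_mono_of_nonneg
      (Filter.Eventually.of_forall fun ω => abs_nonneg _) hai (Filter.Eventually.of_forall fun ω => ?_))
    show |a ω * b ω| ≤ |a ω|
    rw [abs_mul]
    exact mul_le_of_le_one_right (abs_nonneg _) (hb1 ω)
  have h2 : (∫ ω, |a ω| ∂μ) ^ 2 ≤ ∫ ω, |a ω| ^ 2 ∂μ :=
    sq_integral_le_integral_sq ha.norm (C := 1) fun ω => by rw [abs_abs]; exact ha1 ω
  simp only [sq_abs] at h2
  have h0 : 0 ≤ ∫ ω, |a ω| ∂μ := integral_nonneg fun ω => abs_nonneg _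
  calc (∫ ω, a ω * b ω ∂μ) ^ 2 = |∫ ω, a ω * b ω ∂μ| ^ 2 := (sq_abs _).symm
    _ ≤ (∫ ω, |a ω| ∂μ) ^ 2 := pow_le_pow_left₀ (abs_nonneg _) h1 2
    _ ≤ _ := h2

end Abstract

variable {d N : ℕ} {G : Type*} [Group G] [TopologicalSpace G] [IsTopologicalGroup G] [CompactSpace G]
  [MeasurableSpace G] [BorelSpace G] (ρ : G →* Matrix (Fin N) (Fin N) ℂ)

/-! ## The normalised complex loop variable `t_C = tr ρ(hol_x C)/N` -/

/-- **The normalised complex loop variable** `t_C(U) = tr ρ(hol_x(C)(U)) / N` on `ℤ^d`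
configurations (Kazakov–Zheng's `W[C]` before the expectation). [folklore] -/
def loopTrZd (x : Site d) (C : Word d) (U : LGConfig d G) : ℂ :=
  (ρ (wordHolonomyZd U x C)).trace / (N : ℂ)

omit [TopologicalSpace G] [IsTopologicalGroup G] [CompactSpace G] [MeasurableSpace G] [BorelSpace G] in
/-- Unfolding lemma. [folklore] -/
theorem loopTrZd_apply (x : Site d) (C : Word d) (U : LGConfig d G) :
    loopTrZd ρ x C U = (ρ (wordHolonomyZd U x C)).trace / (N : ℂ) := rfl

omit [TopologicalSpace G] [IsTopologicalGroup G] [CompactSpace G] [MeasurableSpace G] [BorelSpace G] in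
/-- `Re t_C = W_x(C)` (the tree's real loop variable `wordLoopZd`). [folklore] -/
theorem loopTrZd_re (x : Site d) (C : Word d) (U : LGConfig d G) :
    (loopTrZd ρ x C U).re = wordLoopZd ρ x C U := by
  rw [loopTrZd, Complex.div_natCast_re, wordLoopZd_apply, div_eq_inv_mul]

omit [MeasurableSpace G] [BorelSpace G] in
/-- `‖tr ρ(g)‖ ≤ N` for a continuous `N`-dimensional representation of a compact group (via the
unitarised form; as in the tree's Wilson-loop files). [folklore] -/
theorem norm_trace_rep_le (hρ : Continuous ρ) (g : G) : ‖(ρ g).trace‖ ≤ N := by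
  rw [← CompactGroup.trace_unitarize ρ hρ, Matrix.trace]
  refine (norm_sum_le _ _).trans ?_
  calc ∑ k, ‖Matrix.diag (CompactGroup.unitarize ρ hρ g) k‖ ≤ ∑ _k : Fin N, (1 : ℝ) :=
        Finset.sum_le_sum fun k _ => CompactGroup.norm_unitarize_apply_le_one ρ hρ g k k
    _ = N := by simp

omit [MeasurableSpace G] [BorelSpace G] in
/-- `‖t_C‖ ≤ 1`. [folklore] -/
theorem norm_loopTrZd_le_one (hρ : Continuous ρ) (x : Site d) (C : Word d) (U : LGConfig d G) :
    ‖loopTrZd ρ x C U‖ ≤ 1 := by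
  rw [loopTrZd, norm_div, Complex.norm_natCast]
  rcases Nat.eq_zero_or_pos N with hN | hN
  · subst hN; simp
  · rw [div_le_one (by exact_mod_cast hN)]
    exact norm_trace_rep_le ρ hρ _

omit [MeasurableSpace G] [BorelSpace G] in
/-- `|Re t_C| ≤ 1`. [folklore] -/
theorem abs_re_loopTrZd_le_one (hρ : Continuous ρ) (x : Site d) (C : Word d) (U : LGConfig d G) :
    |(loopTrZd ρ x C U).re| ≤ 1 :=
  (Complex.abs_re_le_norm _).trans (norm_loopTrZd_le_one ρ hρ x C U)

omit [MeasurableSpace G] [BorelSpace G] in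
/-- `|Im t_C| ≤ 1`. [folklore] -/
theorem abs_im_loopTrZd_le_one (hρ : Continuous ρ) (x : Site d) (C : Word d) (U : LGConfig d G) :
    |(loopTrZd ρ x C U).im| ≤ 1 :=
  (Complex.abs_im_le_norm _).trans (norm_loopTrZd_le_one ρ hρ x C U)

omit [CompactSpace G] in
/-- `t_C` is measurable (product σ-algebra; no countability assumption on `G`). [folklore] -/
theorem measurable_loopTrZd (hρ : Continuous ρ) (x : Site d) (C : Word d) :
    Measurable (loopTrZd (d := d) (G := G) ρ x C) := by
  have h := entryMeasurable_wordHolonomyZd ρ hρ C x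
  have htr : Measurable fun U : LGConfig d G => (ρ (wordHolonomyZd U x C)).trace := by
    simp only [Matrix.trace, Matrix.diag_apply]
    exact Finset.measurable_sum _ fun k _ => h k k
  exact htr.div_const _

omit [CompactSpace G] in
/-- `t_C` is a.e. strongly measurable for every measure. [folklore] -/
theorem aestronglyMeasurable_loopTrZd (hρ : Continuous ρ) (μ : Measure (LGConfig d G)) (x : Site d) (C : Word d) :
    AEStronglyMeasurable (loopTrZd ρ x C) μ :=
  (measurable_loopTrZd ρ hρ x C).aestronglyMeasurable

/-- `t_C` is integrable for every finite measure. [folklore] -/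
theorem integrable_loopTrZd (hρ : Continuous ρ) (μ : Measure (LGConfig d G)) [IsFiniteMeasure μ]
    (x : Site d) (C : Word d) : Integrable (loopTrZd ρ x C) μ :=
  Integrable.of_bound (aestronglyMeasurable_loopTrZd ρ hρ μ x C) 1
    (Filter.Eventually.of_forall (norm_loopTrZd_le_one ρ hρ x C))

/-- `t_A t_B` is integrable for every finite measure. [folklore] -/
theorem integrable_loopTrZd_mul (hρ : Continuous ρ) (μ : Measure (LGConfig d G)) [IsFiniteMeasure μ]
    (x : Site d) (A B : Word d) : Integrable (fun U => loopTrZd ρ x A U * loopTrZd ρ x B U) μ :=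
  Integrable.of_bound ((aestronglyMeasurable_loopTrZd ρ hρ μ x A).mul (aestronglyMeasurable_loopTrZd ρ hρ μ x B)) 1
    (Filter.Eventually.of_forall fun U =>
      norm_mul_le_one_of_norm_le_one (norm_loopTrZd_le_one ρ hρ x A U) (norm_loopTrZd_le_one ρ hρ x B U))

omit [TopologicalSpace G] [IsTopologicalGroup G] [CompactSpace G] [MeasurableSpace G] [BorelSpace G] in
/-- The empty word: `t_{[]} = N/N` (`= 1` for `N ≥ 1`). [folklore] -/
theorem loopTrZd_nil (x : Site d) (U : LGConfig d G) : loopTrZd ρ x ([] : Word d) U = (N : ℂ) / N := by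
  rw [loopTrZd, wordHolonomyZd_nil, map_one, Matrix.trace_one, Fintype.card_fin]

omit [TopologicalSpace G] [IsTopologicalGroup G] [CompactSpace G] [MeasurableSpace G] [BorelSpace G] in
/-- `t_{[]} · z = z` whenever `z` is itself a normalised trace (both vanish for `N = 0`). [folklore] -/
theorem loopTrZd_nil_mul (x : Site d) (C : Word d) (U : LGConfig d G) :
    loopTrZd ρ x ([] : Word d) U * loopTrZd ρ x C U = loopTrZd ρ x C U := by
  rw [loopTrZd_nil]
  rcases Nat.eq_zero_or_pos N with hN | hN
  · subst hN; simp [loopTrZd]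
  · rw [div_self (by exact_mod_cast hN.ne'), one_mul]

omit [MeasurableSpace G] [BorelSpace G] in
/-- **Reversal conjugates**: for a word `C` closed at `x`, `t_{C⁻¹} = conj t_C`
(`hol(C⁻¹) = hol(C)⁻¹` and `tr ρ(g⁻¹) = conj tr ρ(g)` on a compact group). [folklore] -/
theorem loopTrZd_reverse (hρ : Continuous ρ) (x : Site d) {C : Word d} (hC : Word.endpointZd x C = x)
    (U : LGConfig d G) : loopTrZd ρ x C.reverse U = starRingEnd ℂ (loopTrZd ρ x C U) := by
  have h := wordHolonomyZd_reverse U x C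
  rw [hC] at h
  rw [loopTrZd, loopTrZd, h, CompactGroup.trace_map_inv ρ hρ, map_div₀, Complex.conj_natCast]

/-! ## The planar data of a state -/

/-- **`W(C) = Re E t_C`** — Kazakov–Zheng's Wilson-loop variable read at finite `N` for the
state `μ`. [cite: KazakovZheng2023, §2] -/
def loopW (μ : Measure (LGConfig d G)) (x : Site d) (C : Word d) : ℝ :=
  (∫ U, loopTrZd ρ x C U ∂μ).re

/-- **`Q(A, B) = Re E[t_A t_B]`** — the planar product `W[A] W[B]` read at finite `N` as the PAIR
EXPECTATION (the tree's `d(A, B)`). [cite: KazakovZheng2023, §3.2] -/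
def loopQ (μ : Measure (LGConfig d G)) (x : Site d) (A B : Word d) : ℝ :=
  (∫ U, loopTrZd ρ x A U * loopTrZd ρ x B U ∂μ).re

/-- **The imaginary-part covariance** `Γ(A, B) = E[Im t_A · Im t_B]` — the finite-`N` defect
carrier. [folklore] -/
def loopImCov (μ : Measure (LGConfig d G)) (x : Site d) (A B : Word d) : ℝ :=
  ∫ U, (loopTrZd ρ x A U).im * (loopTrZd ρ x B U).im ∂μ

/-- `W(C) = ∫ W_x(C) dμ` (the tree's real loop variable integrated). [folklore] -/
theorem loopW_eq_integral_wordLoopZd (hρ : Continuous ρ) (μ : Measure (LGConfig d G)) [IsFiniteMeasure μ]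
    (x : Site d) (C : Word d) :
    loopW ρ μ x C = ∫ U, wordLoopZd ρ x C U ∂μ := by
  have h := integral_re (integrable_loopTrZd ρ hρ μ x C)
  simp only [RCLike.re_to_complex] at h
  rw [loopW, ← h]
  exact integral_congr_ae (Filter.Eventually.of_forall fun U => loopTrZd_re ρ x C U)

/-- `|W(C)| ≤ 1` for a probability measure. [folklore] -/
theorem abs_loopW_le_one (hρ : Continuous ρ) (μ : Measure (LGConfig d G)) [IsProbabilityMeasure μ]
    (x : Site d) (C : Word d) : |loopW ρ μ x C| ≤ 1 := by
  rw [loopW_eq_integral_wordLoopZd ρ hρ μ]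
  exact abs_integral_wordLoopZd_le_one ρ hρ μ x C

omit [TopologicalSpace G] [IsTopologicalGroup G] [CompactSpace G] [BorelSpace G] in
/-- `Q` is symmetric. [folklore] -/
theorem loopQ_comm (μ : Measure (LGConfig d G)) (x : Site d) (A B : Word d) : loopQ ρ μ x A B = loopQ ρ μ x B A := by
  simp only [loopQ, mul_comm]

omit [TopologicalSpace G] [IsTopologicalGroup G] [CompactSpace G] [BorelSpace G] in
/-- **A trivial split is a linear term**: `Q([], C) = W(C)`. [folklore] -/
theorem loopQ_nil_left (μ : Measure (LGConfig d G)) (x : Site d) (C : Word d) :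
    loopQ ρ μ x [] C = loopW ρ μ x C := by
  simp only [loopQ, loopW, loopTrZd_nil_mul]

omit [TopologicalSpace G] [IsTopologicalGroup G] [CompactSpace G] [BorelSpace G] in
/-- `Q(C, []) = W(C)`. [folklore] -/
theorem loopQ_nil_right (μ : Measure (LGConfig d G)) (x : Site d) (C : Word d) :
    loopQ ρ μ x C [] = loopW ρ μ x C := by
  rw [loopQ_comm, loopQ_nil_left]

omit [TopologicalSpace G] [IsTopologicalGroup G] [CompactSpace G] [BorelSpace G] in
/-- `Γ` is symmetric. [folklore] -/
theorem loopImCov_comm (μ : Measure (LGConfig d G)) (x : Site d) (A B : Word d) :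
    loopImCov ρ μ x A B = loopImCov ρ μ x B A := by
  simp only [loopImCov, mul_comm]

omit [TopologicalSpace G] [IsTopologicalGroup G] [CompactSpace G] [BorelSpace G] in
/-- `Γ(A, A) = E[(Im t_A)²] ≥ 0`. [folklore] -/
theorem loopImCov_self_eq (μ : Measure (LGConfig d G)) (x : Site d) (A : Word d) :
    loopImCov ρ μ x A A = ∫ U, (loopTrZd ρ x A U).im ^ 2 ∂μ := by
  simp only [loopImCov, sq]

omit [TopologicalSpace G] [IsTopologicalGroup G] [CompactSpace G] [BorelSpace G] in
/-- `0 ≤ Γ(A, A)`. [folklore] -/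
theorem loopImCov_self_nonneg (μ : Measure (LGConfig d G)) (x : Site d) (A : Word d) :
    0 ≤ loopImCov ρ μ x A A := by
  rw [loopImCov_self_eq]
  exact integral_nonneg fun U => sq_nonneg _

/-- The integrand of `Γ` is integrable (finite measure). [folklore] -/
theorem integrable_im_mul_im (hρ : Continuous ρ) (μ : Measure (LGConfig d G)) [IsFiniteMeasure μ] (x : Site d)
    (A B : Word d) :
    Integrable (fun U => (loopTrZd ρ x A U).im * (loopTrZd ρ x B U).im) μ := by
  refine Integrable.of_bound ?_ 1 (Filter.Eventually.of_forall fun U => ?_)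
  · exact ((Complex.continuous_im.comp_aestronglyMeasurable (aestronglyMeasurable_loopTrZd ρ hρ μ x A)).mul
      (Complex.continuous_im.comp_aestronglyMeasurable (aestronglyMeasurable_loopTrZd ρ hρ μ x B)))
  · rw [Real.norm_eq_abs, abs_mul]
    exact mul_le_one₀ (abs_im_loopTrZd_le_one ρ hρ x A U) (abs_nonneg _) (abs_im_loopTrZd_le_one ρ hρ x B U)

/-- `|Γ(A, B)| ≤ 1` for a probability measure. [folklore] -/
theorem abs_loopImCov_le_one (hρ : Continuous ρ) (μ : Measure (LGConfig d G)) [IsProbabilityMeasure μ] (x : Site d)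
    (A B : Word d) : |loopImCov ρ μ x A B| ≤ 1 := by
  rw [loopImCov]
  calc |∫ U, (loopTrZd ρ x A U).im * (loopTrZd ρ x B U).im ∂μ|
      ≤ ∫ U, |(loopTrZd ρ x A U).im * (loopTrZd ρ x B U).im| ∂μ := abs_integral_le_integral_abs
    _ ≤ ∫ _U, (1 : ℝ) ∂μ := integral_mono (integrable_im_mul_im ρ hρ μ x A B).abs (integrable_const _) fun U => by
        show |(loopTrZd ρ x A U).im * (loopTrZd ρ x B U).im| ≤ 1
        rw [abs_mul]
        exact mul_le_one₀ (abs_im_loopTrZd_le_one ρ hρ x A U) (abs_nonneg _) (abs_im_loopTrZd_le_one ρ hρ x B U)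
    _ = 1 := by simp

/-- **`Γ(A, B)² ≤ Γ(A, A)`** (`|E[Im t_A Im t_B]| ≤ E|Im t_A| ≤ E[(Im t_A)²]^{1/2}`): the mixed
covariances are controlled by the single-loop second moments. [folklore] -/
theorem sq_loopImCov_le (hρ : Continuous ρ) (μ : Measure (LGConfig d G)) [IsProbabilityMeasure μ] (x : Site d)
    (A B : Word d) : loopImCov ρ μ x A B ^ 2 ≤ loopImCov ρ μ x A A := by
  rw [loopImCov_self_eq, loopImCov]
  exact sq_integral_mul_le_integral_sq
    (Complex.continuous_im.comp_aestronglyMeasurable (aestronglyMeasurable_loopTrZd ρ hρ μ x A))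
    (abs_im_loopTrZd_le_one ρ hρ x A) (abs_im_loopTrZd_le_one ρ hρ x B)

omit [BorelSpace G] in
/-- `Q(A, B⁻¹) = Re E[t_A conj t_B]` for `B` closed at `x`. [folklore] -/
theorem loopQ_reverse_right (hρ : Continuous ρ) (μ : Measure (LGConfig d G)) (x : Site d) (A : Word d) {B : Word d}
    (hB : Word.endpointZd x B = x) :
    loopQ ρ μ x A B.reverse = (∫ U, loopTrZd ρ x A U * starRingEnd ℂ (loopTrZd ρ x B U) ∂μ).re := by
  rw [loopQ]
  congr 2
  funext U
  rw [loopTrZd_reverse ρ hρ x hB]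

/-- ★ **The pair plaquette terms are imaginary-part covariances**: for `B` closed at `x`,
`Q(A, B) − Q(A, B⁻¹) = −2 E[Im t_A · Im t_B]`
(`Re(z w) − Re(z w̄) = −2 Im z Im w`). [folklore] -/
theorem loopQ_sub_loopQ_reverse (hρ : Continuous ρ) (μ : Measure (LGConfig d G)) [IsFiniteMeasure μ] (x : Site d)
    (A : Word d) {B : Word d} (hB : Word.endpointZd x B = x) :
    loopQ ρ μ x A B - loopQ ρ μ x A B.reverse = -2 * loopImCov ρ μ x A B := by
  have hi1 := integrable_loopTrZd_mul ρ hρ μ x A B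
  have hi2 : Integrable (fun U => loopTrZd ρ x A U * starRingEnd ℂ (loopTrZd ρ x B U)) μ :=
    Integrable.of_bound ((aestronglyMeasurable_loopTrZd ρ hρ μ x A).mul
      (Complex.continuous_conj.comp_aestronglyMeasurable (aestronglyMeasurable_loopTrZd ρ hρ μ x B))) 1
      (Filter.Eventually.of_forall fun U => by
        refine norm_mul_le_one_of_norm_le_one (norm_loopTrZd_le_one ρ hρ x A U) ?_
        rw [Complex.norm_conj]; exact norm_loopTrZd_le_one ρ hρ x B U)
  have hr1 := integral_re hi1
  have hr2 := integral_re hi2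
  simp only [RCLike.re_to_complex] at hr1 hr2
  have hi1' : Integrable (fun U => (loopTrZd ρ x A U * loopTrZd ρ x B U).re) μ := hi1.re
  have hi2' : Integrable (fun U => (loopTrZd ρ x A U * starRingEnd ℂ (loopTrZd ρ x B U)).re) μ := hi2.re
  rw [loopQ_reverse_right ρ hρ μ x A hB, loopQ, ← hr1, ← hr2, ← integral_sub hi1' hi2', loopImCov,
    ← integral_const_mul]
  refine integral_congr_ae (Filter.Eventually.of_forall fun U => ?_)
  simp only [Complex.mul_re, Complex.conj_re, Complex.conj_im]
  ring

/-- `Q(A, B⁻¹) − Q(A, B) = 2 Γ(A, B)` (the other orientation). [folklore] -/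
theorem loopQ_reverse_sub_loopQ (hρ : Continuous ρ) (μ : Measure (LGConfig d G)) [IsFiniteMeasure μ] (x : Site d)
    (A : Word d) {B : Word d} (hB : Word.endpointZd x B = x) :
    loopQ ρ μ x A B.reverse - loopQ ρ μ x A B = 2 * loopImCov ρ μ x A B := by
  linarith [loopQ_sub_loopQ_reverse ρ hρ μ x A hB]

/-! ## The relaxation block of a state's planar data -/

variable {ι : Type*} [Fintype ι]

/-- ★★ **Kazakov–Zheng's relaxation block, read on a state's data, is the difference of two second
moments**: for loops `ℓ_A` based at `x` and a rank-one multiplier `m mᵀ`,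
`⟨m mᵀ, [[1, Wᵀ], [W, Q]]⟩ = E(m₀ + Σ_A m_A Re t_{ℓ_A})² − E(Σ_A m_A Im t_{ℓ_A})²`. [folklore] -/
theorem shorPairing_loopData_eq (hρ : Continuous ρ) (μ : Measure (LGConfig d G)) [IsProbabilityMeasure μ] (x : Site d) (ℓ : ι → Word d)
    (m₀ : ℝ) (m : ι → ℝ) :
    shorPairing m₀ m (fun A => loopW ρ μ x (ℓ A)) (fun A B => loopQ ρ μ x (ℓ A) (ℓ B)) =
      (∫ U, (m₀ + ∑ A, m A * (loopTrZd ρ x (ℓ A) U).re) ^ 2 ∂μ) -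
        ∫ U, (∑ A, m A * (loopTrZd ρ x (ℓ A) U).im) ^ 2 ∂μ :=
  shorPairing_integral_eq m₀ m (t := fun A => loopTrZd ρ x (ℓ A))
    (fun A => aestronglyMeasurable_loopTrZd ρ hρ μ x (ℓ A)) (fun A U => norm_loopTrZd_le_one ρ hρ x (ℓ A) U)

/-- ★★ **Hence the block is violated by at most the imaginary-part second moment**:
`⟨m mᵀ, [[1, Wᵀ], [W, Q]]⟩ ≥ −E(Σ_A m_A Im t_{ℓ_A})²`. [folklore] -/
theorem shorPairing_loopData_ge (hρ : Continuous ρ) (μ : Measure (LGConfig d G)) [IsProbabilityMeasure μ] (x : Site d) (ℓ : ι → Word d)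
    (m₀ : ℝ) (m : ι → ℝ) :
    -(∫ U, (∑ A, m A * (loopTrZd ρ x (ℓ A) U).im) ^ 2 ∂μ) ≤
      shorPairing m₀ m (fun A => loopW ρ μ x (ℓ A)) (fun A B => loopQ ρ μ x (ℓ A) (ℓ B)) :=
  shorPairing_integral_ge m₀ m (t := fun A => loopTrZd ρ x (ℓ A))
    (fun A => aestronglyMeasurable_loopTrZd ρ hρ μ x (ℓ A)) (fun A U => norm_loopTrZd_le_one ρ hρ x (ℓ A) U)

/-- ★★ **The crude form in the single-loop covariances**:
`⟨m mᵀ, [[1, Wᵀ], [W, Q]]⟩ ≥ −#ι · Σ_A m_A² Γ(ℓ_A, ℓ_A)`. [folklore] -/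
theorem shorPairing_loopData_ge_card (hρ : Continuous ρ) (μ : Measure (LGConfig d G)) [IsProbabilityMeasure μ] (x : Site d) (ℓ : ι → Word d)
    (m₀ : ℝ) (m : ι → ℝ) :
    -(Fintype.card ι * ∑ A, m A ^ 2 * loopImCov ρ μ x (ℓ A) (ℓ A)) ≤
      shorPairing m₀ m (fun A => loopW ρ μ x (ℓ A)) (fun A B => loopQ ρ μ x (ℓ A) (ℓ B)) := by
  have h := shorPairing_integral_ge_card (μ := μ) m₀ m (t := fun A => loopTrZd ρ x (ℓ A))
    (fun A => aestronglyMeasurable_loopTrZd ρ hρ μ x (ℓ A)) (fun A U => norm_loopTrZd_le_one ρ hρ x (ℓ A) U)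
  simp only [loopImCov_self_eq]
  exact h

/-- **Real loop variables (e.g. a real representation) satisfy Kazakov–Zheng's relaxation at every
`N`**: if every `t_{ℓ_A}` is real, the state's data is feasible for the relaxation block. [folklore] -/
theorem isRelaxationFeasible_loopData_of_im_eq_zero (hρ : Continuous ρ) (μ : Measure (LGConfig d G)) [IsProbabilityMeasure μ] (x : Site d)
    (ℓ : ι → Word d) (hreal : ∀ A U, (loopTrZd ρ x (ℓ A) U).im = 0) :
    IsRelaxationFeasible (fun A => loopW ρ μ x (ℓ A)) (fun A B => loopQ ρ μ x (ℓ A) (ℓ B)) :=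
  isRelaxationFeasible_integral_of_im_eq_zero (μ := μ) (t := fun A => loopTrZd ρ x (ℓ A))
    (fun A => aestronglyMeasurable_loopTrZd ρ hρ μ x (ℓ A)) (fun A U => norm_loopTrZd_le_one ρ hρ x (ℓ A) U) hreal

end Summit.QuantumFields.GaugeBoot

end
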